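import Mathlib.NumberTheory.Padics.PadicVal.Basic
import Mathlib.Analysis.SpecialFunctions.Log.Basic
import Mathlib.Data.Nat.Factorization.Basic
import HarnessLib

/-!
# IUT REPAIR branch (rung LADDER-ABC:A2.RP ⊆ A2.B), class (iii) JOSHI, seat rp-j3 — `CandJoshi33` (rows RP-J33a/b):
# Joshi's GLOBAL scaling claim — «valuation scaling `j²` at the bad primes + renormalisation at the others so that the product formula holds» —
# typed over `ℚ`: the product formula FORCES the renormalisation to be the UNIFORM exponent `j²` (Artin–Whaples uniqueness, elementary case)

Record file (D-0012) of the abc-iut cell, IUT REPAIR branch (human ruling D-0077(2); director-abc 2026-08-26T05:11:35Z + ERRATUM 05:12:15Z; the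
seat's CLAIM 2026-08-26T10:21Z «ATS III §4.2.2 Cor. 4.2.2.4», file slot `k = 33`, REPAIR-SPEC v0.5 §2). TAKES NO SIDE on [IUTchIII] Cor. 3.12 and on
no author. CANDIDATES ARE HYPOTHESES: `H5`, `H4` below are `def … : Prop` READING PREDICATES typed FROM A CLAIM OF AN UNREFEREED SOURCE with its
locator; never asserted, never `sorry`d, not Literature facts (typed ≠ proved ≠ endorsed). GLOBAL / DIAGNOSTIC row: the claim is about the
PRODUCT FORMULA of the number field `L′`, which the frozen Cor. 3.12 interface does not carry (the residual S and every bed of record are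
bad-place-local), so the typing is INTERFACE-FREE arithmetic over `L′ = ℚ` (Mathlib only); the bearing on the census is recorded in prose
(§5 of this docstring) with tree declarations cited BY NAME, none imported. No new `Prop` fact about IUT; no repair fact.

## THE SOURCE CLAIM (render `HOME/lit/renders/Joshi-arxiv-2401.13508/pNNNN.txt`, PDF page = file page; key `paper:arxiv-2401.13508` = ATS III)
* Thm. 4.2.2.1 (4), p. 33 l. 3–36: for `(y′_1, …, y′_{ℓ*}) ∈ Σ̃_{L′}` and `w ∈ V^{odd,ss}`: «one has the following relationship between their
  valuations (4.2.2.2) `|−|_{K_{y′_{w,j}}} = |−|^{j²}_{K_{y′_{w,1}}}` for `j = 1, 2, …, ℓ*`»; (5), p. 33 l. 37–44: «for each `w ∈ V_{L′} − V^{odd,ss}` …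
  (4.2.2.3) `|−|_{K_{y′_{w,j}}} = |−|_{K_{y′_{w,1}}}`».
* Cor. 4.2.2.4, p. 33 l. 78 – p. 34 l. 11: «Mochizuki asserts the content of the next corollary as [Mochizuki, 2021a, Theorem A(ii)]: … the
  non-trivial scaling relationship established by Theorem 4.2.2.1(3) at primes `w ∈ V^{odd,ss}`, forces that suitable (re)normalization of
  valuations must be introduced at primes `w ∈ V_{L′} − V^{odd,ss}` so that the product formula to continue to hold for each normalized
  arithmeticoid `arith(L)^{nor}_{y′_j}` … Proof. This is clear from Theorem 4.2.2.1 and the global constraint placed by the requirement that the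
  product formula holds.» [claim: Joshi2024ATSIII, status: disputed] — source_status: preprint (arXiv); no side taken here.

## THE TYPING. A «(re)normalization of valuations» of `L′ = ℚ` is a vector of place exponents: `c p` at the prime `p` (the place's absolute value
replaced by `|−|_p^{c p}`) and `c∞` at the real place; its logarithmic size of `x ∈ ℚˣ` is `wlog c c∞ x := c∞·log|x|_∞ − Σ_p c_p·v_p(x)·log p`, and
«the product formula holds for the normalized arithmeticoid» is `PF c c∞ := ∀ x ≠ 0, wlog c c∞ x = 0`. The structure `y′_j` of a Θ^gau-link has
exponent `j²` at the bad primes (Thm. 4.2.2.1 (4)).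
* `H5 Vbad j` (RP-J33a — Thm. 4.2.2.1 (4) AND (5) AS PRINTED, with the product formula): exponent `j²` on `Vbad`, exponent `1` at every other
  place including `∞`, and `PF`.
* `H4 Vbad j` (RP-J33b — Cor. 4.2.2.4: «suitable (re)normalization … at primes `w ∉ V^{odd,ss}`»): SOME exponent vector agreeing with `j²` on
  `Vbad` (free elsewhere, free at `∞`) satisfies `PF`.
Reading choices: `L′ = ℚ` (the smallest case; the general number-field statement is Artin–Whaples' uniqueness of the product formula —
TODO(general form): for a number field every product-formula relation among the standard places is a power of the standard one); «valuation
scaling `|−|^{j²}`» ↦ exponent `c p = j²`; the archimedean place is allowed to renormalise too (more generous than print, which renormalises only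
«at primes»).

## RESULTS (kernel, Mathlib only)
* `PF_forces_constant`: ANY exponent vector satisfying the product formula over `ℚ` is CONSTANT — `c p = c∞` for every prime `p` (test `x = p`).
* `not_H5` (RP-J33a, T-c-type verdict «CONTRADICTS the product formula»): if `Vbad` contains a prime and `j ≥ 2`, (4)+(5)+PF is INCONSISTENT.
* `PF_std` (the product formula of `ℚ`: `log|x| = Σ_p v_p(x)·log p`, from unique factorisation) and `wlog_uniform` (a uniform exponent `N`
  multiplies every logarithmic size by `N`) ⇒ `uniform_witnesses_H4`: Cor. 4.2.2.4 IS satisfiable — by the UNIFORM exponent `c ≡ j²`, `c∞ = j²` — and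
  `H4_witness_uniform`: EVERY witness is that uniform vector. So «renormalisation at the other primes» = «raise EVERY place, the archimedean one
  included, to the same power `j²`»: the normalized arithmeticoid `arith(L)^{nor}_{y′_j}` is the uniform `j²`-power of `arith(L)_{y′_1}`, under
  which EVERY logarithmic size — degrees of all arithmetic divisors (the q-pilot's included) AND log-volumes of all log-shells — is multiplied by
  the same `j²` (`wlog_uniform`): no place-wise compensation distinguishes the Θ-side from the q-side.
## BEARING ON THE CENSUS (prose; tree decls cited by name, not imported). (i) The product formula does not select the per-label uniform factor:
`PF_uniform N` holds for EVERY `N` — for Thm. 4.2.2.1 (4)'s `j²` as for (9.9.4)'s `j²/ℓ*²` (p. 121 l. 37–66, the exponent Joshi's proof of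
Thm. 9.11.1 / Cor. 9.11.1.1 computes with). (ii) On the beds of record that factor DECIDES the typed Corollary: honest `j²`-scaling read in ONE
container is the countermodel CM (`Cor312Vol.PinnedWitness.pinnedSetting_not_statement`, `pinnedSetting_negLogTheta_eq_mul_negLogQ`: `−|log Θ| =
(5/2)·(−|log q|)`); the `j²/ℓ*²`-normalised reading is rp-j1's standard-point bed (`Repair.CandJoshi1BridgeE.std_E_and_B`: E-t4's
`Joshi.ThetaValuationScaling` ∧ Statement ∧ ¬S) and rp-m3's N-th-power axis (`Repair.CandMochizuki31.statement_iff_hullInflation_pow`).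
(iii) Hence Cor. 4.2.2.4, typed, is TRUE-BUT-UNIFORM: it cannot be the place where a compensation between Θ-side and q-side sizes arises; the
residual S (bad-place-local) is untouched by it — RP-J33 is a GLOBAL-DIAGNOSTIC row, T-a n/a, T-b/T-c at the interface n/a. HONEST SCOPE:
`L′ = ℚ`; exponents real; a typing ≠ an endorsement or a refutation of the source's intent. Standard axioms only.
-/

noncomputable section

open Finset

namespace Summit.ABC.IUTFork.Repair.CandJoshi33

/-! ## 1. Renormalised logarithmic sizes over `ℚ` and the product formula -/

/-- The finite set of primes at which `x ∈ ℚ` can have nonzero valuation: the prime factors of `|num(x)|·den(x)`. [folklore] -/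
def primesOf (x : ℚ) : Finset ℕ := (x.num.natAbs * x.den).primeFactors

/-- **The `c`-renormalised logarithmic size** of `x ∈ ℚˣ`: `c∞·log|x|_∞ − Σ_p c_p·v_p(x)·log p` (exponent `c p` at the prime `p`, `c∞` at the
real place; the standard normalisation is `c ≡ 1`, `c∞ = 1`). [folklore] -/
def wlog (c : ℕ → ℝ) (cinf : ℝ) (x : ℚ) : ℝ :=
  cinf * Real.log |(x : ℝ)| - ∑ p ∈ primesOf x, c p * (padicValRat p x : ℝ) * Real.log p

/-- **«The product formula holds for the normalized arithmeticoid»**: every nonzero rational has renormalised logarithmic size `0`. [folklore] -/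
def PF (c : ℕ → ℝ) (cinf : ℝ) : Prop := ∀ x : ℚ, x ≠ 0 → wlog c cinf x = 0

/-! ## 2. The candidates H₅ (RP-J33a) and H₄ (RP-J33b) -/

/-- **CANDIDATE `H5` (class Joshi, sub-cell B3; row RP-J33a) — hypothesis, NOT asserted; typed ≠ proved.** «Thm. 4.2.2.1 (4) AND (5) AS PRINTED,
with the product formula»: the structure `y′_j` has exponent `j²` at the bad primes `Vbad` ((4), p. 33 l. 3–36, (4.2.2.2)), exponent `1` at
every other place ((5), p. 33 l. 37–44, (4.2.2.3); `∞` included), and its product formula holds (Cor. 4.2.2.4's requirement). SOURCE: ATS III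
`paper:arxiv-2401.13508`. LEVEL: global/diagnostic (interface-free, `L′ = ℚ`). Reading choices: module docstring. [claim: Joshi2024ATSIII, status: disputed] -/
@[claim "Joshi2024ATSIII" "disputed"]
def H5 (Vbad : Finset ℕ) (j : ℕ) : Prop :=
  PF (fun p => if p ∈ Vbad then ((j : ℝ) ^ 2) else 1) 1

/-- **CANDIDATE `H4` (row RP-J33b) — hypothesis, NOT asserted; typed ≠ proved.** «Cor. 4.2.2.4»: SOME (re)normalisation of the places outside
`Vbad` (free exponents off `Vbad`, free at `∞`), keeping `j²` on `Vbad`, makes the product formula hold (p. 33 l. 78 – p. 34 l. 11 «suitable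
(re)normalization of valuations must be introduced at primes `w ∈ V_{L′} − V^{odd,ss}` so that the product formula continue[s] to hold»).
LEVEL: global/diagnostic. [claim: Joshi2024ATSIII, status: disputed] -/
@[claim "Joshi2024ATSIII" "disputed"]
def H4 (Vbad : Finset ℕ) (j : ℕ) : Prop :=
  ∃ (c : ℕ → ℝ) (cinf : ℝ), (∀ p ∈ Vbad, c p = (j : ℝ) ^ 2) ∧ PF c cinf

/-! ## 3. Uniqueness: the product formula forces a CONSTANT exponent vector -/

/-- The support primes of a prime `q` are `{q}`. [folklore] -/
theorem primesOf_prime {q : ℕ} (hq : q.Prime) : primesOf (q : ℚ) = {q} := by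
  unfold primesOf
  have h1 : ((q : ℚ)).num.natAbs = q := by simp
  have h2 : ((q : ℚ)).den = 1 := by simp
  rw [h1, h2, mul_one, hq.primeFactors]

/-- **The renormalised size of a prime `q` is `(c∞ − c_q)·log q`.** [folklore] -/
theorem wlog_prime (c : ℕ → ℝ) (cinf : ℝ) {q : ℕ} (hq : q.Prime) :
    wlog c cinf (q : ℚ) = (cinf - c q) * Real.log q := by
  haveI : Fact q.Prime := ⟨hq⟩
  unfold wlog
  rw [primesOf_prime hq, sum_singleton, padicValRat.self hq.one_lt]
  have : |((q : ℚ) : ℝ)| = (q : ℝ) := by push_cast; exact abs_of_nonneg (Nat.cast_nonneg q)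
  rw [this]
  push_cast
  ring

/-- **UNIQUENESS (Artin–Whaples, elementary case `ℚ`)**: an exponent vector satisfying the product formula is CONSTANT — every prime carries
the exponent of the real place. (Test the product formula on `x = p`.) [folklore] -/
theorem PF_forces_constant {c : ℕ → ℝ} {cinf : ℝ} (h : PF c cinf) {p : ℕ} (hp : p.Prime) : c p = cinf := by
  have h1 := h (p : ℚ) (Nat.cast_ne_zero.2 hp.ne_zero)
  rw [wlog_prime c cinf hp] at h1
  have hlog : Real.log p ≠ 0 := (Real.log_pos (by exact_mod_cast hp.one_lt)).ne'
  have := (mul_eq_zero.1 h1).resolve_right hlog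
  linarith

/-- **RP-J33a: (4)+(5)+product formula is INCONSISTENT** as soon as there is a bad prime and `j ≥ 2`: at a bad prime `p` the vector has
exponent `j² ≠ 1 = c∞`. [folklore] -/
theorem not_H5 {Vbad : Finset ℕ} {j : ℕ} (hV : ∃ p ∈ Vbad, p.Prime) (hj : 2 ≤ j) : ¬ H5 Vbad j := by
  obtain ⟨p, hpV, hp⟩ := hV
  intro h
  have hc := PF_forces_constant h hp
  rw [if_pos hpV] at hc
  have hj' : (2 : ℝ) ≤ j := by exact_mod_cast hj
  nlinarith

/-- **RP-J33b, uniqueness half: every witness of Cor. 4.2.2.4 is the UNIFORM vector** `c ≡ j²` on the primes, `c∞ = j²`. [folklore] -/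
theorem H4_witness_uniform {Vbad : Finset ℕ} {j : ℕ} (hV : ∃ p ∈ Vbad, p.Prime) {c : ℕ → ℝ} {cinf : ℝ}
    (hcV : ∀ p ∈ Vbad, c p = (j : ℝ) ^ 2) (h : PF c cinf) :
    cinf = (j : ℝ) ^ 2 ∧ ∀ p : ℕ, p.Prime → c p = (j : ℝ) ^ 2 := by
  obtain ⟨p₀, hp₀V, hp₀⟩ := hV
  have h0 : cinf = (j : ℝ) ^ 2 := by rw [← hcV p₀ hp₀V, PF_forces_constant h hp₀]
  exact ⟨h0, fun p hp => by rw [PF_forces_constant h hp, h0]⟩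

/-! ## 4. Existence: the product formula of `ℚ`, and uniform exponents -/

/-- A uniform exponent `N` multiplies every renormalised size by `N`. [folklore] -/
theorem wlog_uniform (N : ℝ) (x : ℚ) : wlog (fun _ => N) N x = N * wlog (fun _ => 1) 1 x := by
  unfold wlog
  rw [mul_sub, mul_sum, one_mul]
  congr 1
  exact sum_congr rfl fun p _ => by ring

/-- `log n = Σ_{p ∈ S} v_p(n)·log p` for any finite set of primes `S` containing the prime factors of `n ≠ 0`. [folklore] -/
theorem log_nat_eq_sum {n : ℕ} (hn : n ≠ 0) {S : Finset ℕ} (hS : n.primeFactors ⊆ S) (hSp : ∀ p ∈ S, p.Prime) :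
    Real.log n = ∑ p ∈ S, (n.factorization p : ℝ) * Real.log p := by
  have hprod : ∏ p ∈ S, p ^ n.factorization p = n := by
    rw [← prod_subset hS fun p _ hpn => by rw [Finsupp.notMem_support_iff.1 (by rwa [Nat.support_factorization]), pow_zero]]
    exact Nat.prod_factorization_pow_eq_self hn
  have hprodR : (∏ p ∈ S, (p : ℝ) ^ n.factorization p) = n := by exact_mod_cast hprod
  rw [← hprodR, Real.log_prod (s := S) fun p hp => pow_ne_zero _ (Nat.cast_ne_zero.2 (hSp p hp).ne_zero)]
  exact sum_congr rfl fun p _ => by rw [Real.log_pow]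

/-- `v_p(x) = v_p(|num x|) − v_p(den x)` as integers, through the factorisations. [folklore] -/
theorem padicValRat_eq_factorization (x : ℚ) {p : ℕ} (hp : p.Prime) :
    padicValRat p x = (x.num.natAbs.factorization p : ℤ) - (x.den.factorization p : ℤ) := by
  rw [Nat.factorization_def _ hp, Nat.factorization_def _ hp]
  rfl

/-- **THE PRODUCT FORMULA OF `ℚ`** (standard normalisation): `log|x|_∞ = Σ_p v_p(x)·log p` for `x ≠ 0`. [folklore] -/
theorem PF_std : PF (fun _ => 1) 1 := by
  intro x hx
  unfold wlog
  have ha : x.num.natAbs ≠ 0 := Int.natAbs_ne_zero.2 (Rat.num_ne_zero.2 hx)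
  have hb : x.den ≠ 0 := x.den_nz
  have hSp : ∀ p ∈ primesOf x, p.Prime := fun p hp => Nat.prime_of_mem_primeFactors hp
  have hSa : x.num.natAbs.primeFactors ⊆ primesOf x := by
    unfold primesOf; rw [Nat.primeFactors_mul ha hb]; exact subset_union_left
  have hSb : x.den.primeFactors ⊆ primesOf x := by
    unfold primesOf; rw [Nat.primeFactors_mul ha hb]; exact subset_union_right
  have habs : |(x : ℝ)| = (x.num.natAbs : ℝ) / (x.den : ℝ) := by
    rw [Rat.cast_def, abs_div, Nat.cast_natAbs, Int.cast_abs,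
      abs_of_pos (show (0 : ℝ) < (x.den : ℝ) by exact_mod_cast x.den_pos)]
  rw [habs, Real.log_div (Nat.cast_ne_zero.2 ha) (Nat.cast_ne_zero.2 hb), one_mul, log_nat_eq_sum ha hSa hSp,
    log_nat_eq_sum hb hSb hSp, ← sum_sub_distrib, sub_eq_zero]
  refine sum_congr rfl fun p hp => ?_
  rw [one_mul, padicValRat_eq_factorization x (hSp p hp)]
  push_cast
  ring

/-- The product formula holds for EVERY uniform exponent vector. [folklore] -/
theorem PF_uniform (N : ℝ) : PF (fun _ => N) N := fun x hx => by
  rw [wlog_uniform, PF_std x hx, mul_zero]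

/-- **RP-J33b, existence half: Cor. 4.2.2.4 IS satisfiable — by the uniform exponent `j²` at every place, `∞` included.** [folklore] -/
theorem uniform_witnesses_H4 (Vbad : Finset ℕ) (j : ℕ) : H4 Vbad j :=
  ⟨fun _ => (j : ℝ) ^ 2, (j : ℝ) ^ 2, fun _ _ => rfl, PF_uniform _⟩

/-! ## 5. The packaged verdict of rows RP-J33a/b -/

/-- **`joshi_productFormula_census`**: for every finite set of bad primes containing a prime and every label `j ≥ 2`: (a) Thm. 4.2.2.1 (4)+(5)
with the product formula is inconsistent (`¬ H5`); (b) Cor. 4.2.2.4 holds (`H4`) and EVERY renormalisation witnessing it is the UNIFORM vector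
`j²` at all places — so every logarithmic size is multiplied by the same `j²` (`wlog_uniform`), and the product formula holds equally for any other
uniform factor (`PF_uniform`, e.g. (9.9.4)'s `j²/ℓ*²`). Interface-free arithmetic over `ℚ`; no side taken. [folklore] -/
theorem joshi_productFormula_census {Vbad : Finset ℕ} (hV : ∃ p ∈ Vbad, p.Prime) {j : ℕ} (hj : 2 ≤ j) :
    ¬ H5 Vbad j ∧ H4 Vbad j ∧
      (∀ (c : ℕ → ℝ) (cinf : ℝ), (∀ p ∈ Vbad, c p = (j : ℝ) ^ 2) → PF c cinf →
        cinf = (j : ℝ) ^ 2 ∧ ∀ p : ℕ, p.Prime → c p = (j : ℝ) ^ 2) ∧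
      (∀ (N : ℝ) (x : ℚ), wlog (fun _ => N) N x = N * wlog (fun _ => 1) 1 x) ∧ (∀ N : ℝ, PF (fun _ => N) N) :=
  ⟨not_H5 hV hj, uniform_witnesses_H4 Vbad j, fun _ _ hcV h => H4_witness_uniform hV hcV h, wlog_uniform, PF_uniform⟩

/-! ## 6. (v2, APPEND-ONLY) The closed form: the product-formula-compatible renormalisations of `ℚ` are EXACTLY the uniform ones -/

/-- Two exponent vectors agreeing at every prime have the same renormalised sizes (`wlog` evaluates `c` at primes only). [folklore] -/
theorem wlog_congr_primes {c c' : ℕ → ℝ} (h : ∀ p : ℕ, p.Prime → c p = c' p) (cinf : ℝ) (x : ℚ) : wlog c cinf x = wlog c' cinf x := by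
  unfold wlog
  congr 1
  exact sum_congr rfl fun p hp => by rw [h p (Nat.prime_of_mem_primeFactors hp)]

/-- **ARTIN–WHAPLES, elementary case (closed form over `ℚ`)**: an exponent vector `(c, c∞)` satisfies the product formula IFF it is UNIFORM —
`c p = c∞` at every prime `p` (the real place's exponent `c∞` being arbitrary). So the (re)normalisations of the valuations of `ℚ` for which
«the product formula continues to hold» (ATS III Cor. 4.2.2.4) are exactly the uniform powers of the standard one. [folklore] -/
theorem PF_iff_uniform (c : ℕ → ℝ) (cinf : ℝ) : PF c cinf ↔ ∀ p : ℕ, p.Prime → c p = cinf :=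
  ⟨fun h _ hp => PF_forces_constant h hp, fun h x hx => by
    rw [wlog_congr_primes (c' := fun _ => cinf) h cinf x, PF_uniform cinf x hx]⟩

/-- **RP-J33b, closed form**: a renormalisation keeping `j²` on a set `Vbad` containing a prime satisfies the product formula iff it is the uniform
vector `j²` (every prime AND the real place). [folklore] -/
theorem H4_witness_iff {Vbad : Finset ℕ} {j : ℕ} (hV : ∃ p ∈ Vbad, p.Prime) (c : ℕ → ℝ) (cinf : ℝ)
    (hcV : ∀ p ∈ Vbad, c p = (j : ℝ) ^ 2) :
    PF c cinf ↔ cinf = (j : ℝ) ^ 2 ∧ ∀ p : ℕ, p.Prime → c p = (j : ℝ) ^ 2 :=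
  ⟨fun h => H4_witness_uniform hV hcV h, fun ⟨h0, h⟩ => (PF_iff_uniform c cinf).2 fun p hp => by rw [h p hp, h0]⟩

end Summit.ABC.IUTFork.Repair.CandJoshi33

end
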